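import Mathlib
import Summits.NavierStokesRegularity.NavierStokesRegularity.Theorems.FilamentSkeletonRssAnalyticStripLiaSymbolSeriesWindow

/-!
# Low-band ELLIPTICITY of the exact self-induction symbol: `−x²·log(1/x) ≤ 𝔖(x) ≤ −(x²/5)·log(1/x)` on `(0, 1/4]`
# (`TangentSkeletonNearStraightL`, stmt-NavierStokesRegularity-23320; symbol-level input of the strategist's (R♯-lo) «bending dominance»)

The linear heart (R♯) of the crux's Newton line needs, on the LOW band `kμ ≤ x₁`, that the local-induction ("bending") multiplier
`−𝔖(kμ)·(2/μ²)·(Γγ/4π)` is comparable to `k²·log(1/(kμ))` from both sides — the Gårding input of the strategist's (R♯-lo)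
`LowBandCoupledBeamL` (`Cruxes/SkeletonJ1L/STRATEGY-CENSUS.md` PART III §D5: «bending symbol `(Γγ/4π)k²(log(2/kμ) − γ_E + ½)` dominates
`‖S_⊥‖ + ‖B‖ = O(γ/ρ²)`»).  The tree holds the Klein–Majda asymptotics with remainder (clause (c) of `LiaSymbolBound`, KERNEL-ONLY since
p824053 `liaSymbolBound_kernel`: `|𝔖(x) − x²((log(x/2)+γ_E)/2 + 1/4)| ≤ x⁴(|log x|+1)` on `(0, ½]`) and kernel-certified NEGATIVITY windows
on `[1/5, 1]` (Clause13 lanes); this file turns the asymptotic clause into the clean two-sided LOW-BAND window adjoining them: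

* `liaSym_lowBand_upper` : `𝔖(x) ≤ −(x²/5)·log(1/x)` for `0 < x ≤ 1/4`;
* `liaSym_lowBand_lower` : `−x²·log(1/x) ≤ 𝔖(x)` for `0 < x ≤ 1/4`;
using `0.57721 ≤ γ_E ≤ 0.57726` (`Series.eulerMascheroni_bounds`, p823505) and `log 2 > 0.6931471803` (Mathlib).

HONEST FRAMING: an S-sized corollary (symbol window) for the linear theory of a HYPOTHETICAL filament skeleton on the NEGATIVE side of a
MODEL route; no registered stub of 23320 is proved; nothing here bears on Navier–Stokes regularity or blow-up.
`--supports stmt-NavierStokesRegularity-23320`.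
-/

set_option linter.dupNamespace false

noncomputable section

open Real Set

namespace Summit.NavierStokesRegularity.NavierStokesRegularity.Theorems.TangentSkeletonNearStraightLSwirlBand

open Summit.NavierStokesRegularity.NavierStokesRegularity.Theorems.AnalyticStripLiaSymbol

/-- Numerical constants: `γ_E − log 2 + 1/2 ∈ [0, 0.3842]` and `log 4 ≥ 1.386`. [folklore] -/
theorem lowBand_constants :
    0 ≤ Real.eulerMascheroniConstant - Real.log 2 + 1 / 2 ∧
    Real.eulerMascheroniConstant - Real.log 2 + 1 / 2 ≤ 0.3842 ∧ (1.386 : ℝ) ≤ Real.log 4 := by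
  obtain ⟨hγ1, hγ2⟩ := Series.eulerMascheroni_bounds
  have hl2a : (0.6931471803 : ℝ) < Real.log 2 := Real.log_two_gt_d9
  have hl2b : Real.log 2 < (0.6931471808 : ℝ) := Real.log_two_lt_d9
  have hl4 : Real.log 4 = 2 * Real.log 2 := by
    rw [show (4:ℝ) = 2 ^ 2 by norm_num, Real.log_pow]; norm_num
  refine ⟨by linarith, by linarith, by rw [hl4]; linarith⟩

/-- **Low-band upper window**: `𝔖(x) ≤ −(x²/5)·log(1/x)` for `0 < x ≤ 1/4` — the bending multiplier `−𝔖(kμ)` is at least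
`(1/5)(kμ)²·log(1/(kμ))` on the low band. [folklore; from clause (c) of `LiaSymbolBound`, p824053] -/
theorem liaSym_lowBand_upper {x : ℝ} (hx : 0 < x) (hx4 : x ≤ 1 / 4) :
    liaSym x ≤ -(x ^ 2 / 5 * Real.log (1 / x)) := by
  have hc := liaSymbolBound_kernel.1.2.2 x hx (by linarith)
  obtain ⟨h0, h1, h4⟩ := lowBand_constants
  -- `L = log(1/x) = -log x ≥ log 4`
  have hL : Real.log (1 / x) = -Real.log x := by rw [one_div, Real.log_inv]
  have hlogx : Real.log x ≤ -Real.log 4 := by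
    have := Real.log_le_log hx hx4
    rw [one_div, Real.log_inv] at this; exact this
  have hLge : 1.386 ≤ -Real.log x := by linarith
  have habs : |Real.log x| = -Real.log x := abs_of_neg (by linarith)
  have hx2 : x ^ 2 ≤ 1 / 16 := by nlinarith
  have hx2pos : 0 < x ^ 2 := by positivity
  rw [habs] at hc
  have hup := (abs_le.mp hc).2
  rw [Real.log_div hx.ne' two_ne_zero] at hup
  rw [hL]
  -- `𝔖 ≤ x²((log x - log 2 + γ)/2 + 1/4) + x⁴(-log x + 1)`; want `≤ (x²/5)·log x`
  set L := -Real.log x with hLdef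
  have hlx : Real.log x = -L := by rw [hLdef]; ring
  rw [hlx] at hup
  have hx4' : x ^ 4 = x ^ 2 * x ^ 2 := by ring
  rw [hx4'] at hup
  -- reduce to: x²·[ -L/2 + (γ - log2 + 1/2)/2 + x²(L+1) + L/5 ] ≤ 0
  have key : -L / 2 + (Real.eulerMascheroniConstant - Real.log 2 + 1 / 2) / 2 + x ^ 2 * (L + 1) + L / 5 ≤ 0 := by
    nlinarith [mul_le_mul_of_nonneg_right hx2 (by linarith : 0 ≤ L + 1)]
  nlinarith [mul_le_mul_of_nonneg_left key hx2pos.le]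

/-- **Low-band lower window**: `−x²·log(1/x) ≤ 𝔖(x)` for `0 < x ≤ 1/4` — the bending multiplier is at most
`(kμ)²·log(1/(kμ))` there. [folklore; from clause (c) of `LiaSymbolBound`, p824053] -/
theorem liaSym_lowBand_lower {x : ℝ} (hx : 0 < x) (hx4 : x ≤ 1 / 4) :
    -(x ^ 2 * Real.log (1 / x)) ≤ liaSym x := by
  have hc := liaSymbolBound_kernel.1.2.2 x hx (by linarith)
  obtain ⟨h0, h1, h4⟩ := lowBand_constants
  have hL : Real.log (1 / x) = -Real.log x := by rw [one_div, Real.log_inv]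
  have hlogx : Real.log x ≤ -Real.log 4 := by
    have := Real.log_le_log hx hx4
    rw [one_div, Real.log_inv] at this; exact this
  have hLge : 1.386 ≤ -Real.log x := by linarith
  have habs : |Real.log x| = -Real.log x := abs_of_neg (by linarith)
  have hx2 : x ^ 2 ≤ 1 / 16 := by nlinarith
  have hx2pos : 0 < x ^ 2 := by positivity
  rw [habs] at hc
  have hlo := (abs_le.mp hc).1
  rw [Real.log_div hx.ne' two_ne_zero] at hlo
  rw [hL]
  set L := -Real.log x with hLdef
  have hlx : Real.log x = -L := by rw [hLdef]; ring
  rw [hlx] at hlo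
  have hx4' : x ^ 4 = x ^ 2 * x ^ 2 := by ring
  rw [hx4'] at hlo
  -- reduce to: x²·[ -L/2 + (γ - log2 + 1/2)/2 - x²(L+1) + L ] ≥ 0
  have key : 0 ≤ -L / 2 + (Real.eulerMascheroniConstant - Real.log 2 + 1 / 2) / 2 - x ^ 2 * (L + 1) + L := by
    nlinarith [mul_le_mul_of_nonneg_right hx2 (by linarith : 0 ≤ L + 1)]
  nlinarith [mul_le_mul_of_nonneg_left key hx2pos.le]

end Summit.NavierStokesRegularity.NavierStokesRegularity.Theorems.TangentSkeletonNearStraightLSwirlBand
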